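import Summits.AnomalousDissipation.AnomalousDissipation.Theorems.SawtoothPulseCascadeK1LocalisedCascadeHalfStepV

/-!
# K1loc, line `Spectral` / thin start — helper: THE WINDOW LEMMA WITH FIBREWISE `L²` MID-BAND MASS (S-D step, sharp form)

Helper file of the prover lane on the crux `K1LocalisedCascade` (stmt-AnomalousDissipation-19491), route `SawtoothPulseCascade`
(S-B/S-C assembly seat; a tool offered to the S-D fibre ledger).  `…FibreWindow` / `…FibreWindowTwo` / `…HalfStepV` pay the
mid-band part `g^mid_n` of the chirp through ONE pointwise majorant `‖g^mid_n(b)‖ ≤ ρ(b)` common to all fibres of the window —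
`∫ρ(x_j)²‖θ₁‖²` — which for the exact comb costs `∫ρ² ≈ 16NAc″/D`, one to two orders of magnitude above the true mid-band energy
`‖g^mid_n‖²_{L²(𝕋)} = Σ_m |ψ_n(m)|²|ĝ_n(m)|²` (a SIDEBAND ENERGY of the chirp, `≈ 0.4N/D`, `…ExactChirp`).  This file records the
alternative bookkeeping in which the mid-band is paid fibre by fibre in `L²` and the INPUT is paid through the sup norm of its
fibre coefficient `A^i_nθ₁(x) = ∫e_{−n}(s)θ₁(x + se_i)ds` (a function of `x_j` up to a phase):
* `sum_sq_norm_mid_le_fibreL2`: `Σ_{k∈W}‖𝓕(g^mid_{k_i}(x_j)·A^i_{k_i}θ₁)(k)‖² ≤ Σ_{n∈F} E_n·S_n²` whenever `∫_𝕋‖g^mid_n‖² ≤ E_n` and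
  `‖A^i_nθ₁‖ ≤ S_n` pointwise (`F` = fibres met by `W`);
* `sum_window_sq_norm_comp_shearMap_le_fibreL2`: the window lemma with this mid-band term and the fibre-restricted pass-through term:
  `Σ_{k∈W}‖𝓕((θ₁+θ₂)∘Φ)(k)‖² ≤ (√(Σ_{n∈F}E_nS_n²) + √(Σ_{n∈F}∫‖A^i_nθ₂‖²))²`.
The input `S_n` is where structure enters: at phase 1 of the cascade `S_n² ≤ 2·(fibre energy)` exactly (two input fibres,
`…PhaseOneModes`); later, fibre equidistribution along chords.  No definitions; nothing about the crux.
[cite: Grafakos2014, Prop. 3.1.2 (5) and Prop. 3.2.7 (3)] [problem: turb]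
-/

-- `Summit.<Summit>.<Problem>`: single-conjunct summit, the duplicate namespace segment is deliberate.
set_option linter.dupNamespace false

noncomputable section

namespace Summit.AnomalousDissipation.AnomalousDissipation.Theorems.SawtoothPulseCascade.K1Window

open MeasureTheory Set Filter Topology UnitAddTorus Function Complex
open scoped Real ENNReal
open Literature.Analysis Literature.Analysis.FunctionSpaces Literature.Analysis.FunctionSpaces.Torus Literature.Analysis.FluidPDE
open Summit.AnomalousDissipation.AnomalousDissipation.Theorems.SawtoothPulseCascade.K1Start

variable {d : Type*} [Fintype d] [DecidableEq d]

/-- **Mid-band term, fibrewise `L²` form**: if on every fibre `n` met by the window `∫_𝕋‖g^mid_n‖² ≤ E_n` and the fibre coefficient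
of the input is bounded, `‖A^i_nθ₁(x)‖ ≤ S_n`, then `Σ_{k∈W}‖𝓕(g^mid_{k_i}(x_j)A^i_{k_i}θ₁)(k)‖² ≤ Σ_{n∈F} E_n S_n²`
(Bessel on each fibre, `∫‖g^mid_n(x_j)‖²‖A^i_nθ₁(x)‖²dx ≤ S_n²∫_𝕋‖g^mid_n‖²`). [cite: Grafakos2014, Prop. 3.2.7 (3)] -/
theorem sum_sq_norm_mid_le_fibreL2 {θ₁ : UnitAddTorus d → ℂ} (hθ₁ : Continuous θ₁) {i j : d} (hij : i ≠ j)
    (W : Finset (d → ℤ)) (gmid : ℤ → UnitAddCircle → ℂ) (hgmid : ∀ n, Continuous (gmid n)) {E S : ℤ → ℝ}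
    (hE : ∀ k ∈ W, ∫ b : UnitAddCircle, ‖gmid (k i) b‖ ^ 2 ≤ E (k i))
    (hS : ∀ k ∈ W, ∀ x : UnitAddTorus d, ‖∫ s : UnitAddCircle, (fourier (-(k i)) s : ℂ) • θ₁ (x + Pi.single i s)‖ ≤ S (k i)) :
    ∑ k ∈ W, ‖mFourierCoeff (fun x => gmid (k i) (x j) *
        ∫ s : UnitAddCircle, (fourier (-(k i)) s : ℂ) • θ₁ (x + Pi.single i s)) k‖ ^ 2 ≤
      ∑ n ∈ W.image (fun k => k i), E n * S n ^ 2 := by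
  classical
  have _ := hij
  set A₁ : ℤ → UnitAddTorus d → ℂ := fun n x => ∫ s : UnitAddCircle, (fourier (-n) s : ℂ) • θ₁ (x + Pi.single i s) with hA₁
  set H₁ : ℤ → UnitAddTorus d → ℂ := fun n x => gmid n (x j) * A₁ n x with hH₁
  have hA₁c : ∀ n, Continuous (A₁ n) := fun n => continuous_twistedAxisAvg hθ₁ i n
  have hH₁c : ∀ n, Continuous (H₁ n) := fun n => ((hgmid n).comp (continuous_apply j)).mul (hA₁c n)
  set F : Finset ℤ := W.image fun k => k i with hF
  have hmaps : ∀ k ∈ W, k i ∈ F := fun k hk => Finset.mem_image_of_mem _ hk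
  -- Bessel on each fibre
  have hfib : ∑ k ∈ W, ‖mFourierCoeff (H₁ (k i)) k‖ ^ 2 ≤ ∑ n ∈ F, ∫ x : UnitAddTorus d, ‖H₁ n x‖ ^ 2 := by
    rw [← Finset.sum_fiberwise_of_maps_to hmaps]
    refine Finset.sum_le_sum fun n hn => ?_
    calc ∑ k ∈ W with k i = n, ‖mFourierCoeff (H₁ (k i)) k‖ ^ 2
        = ∑ k ∈ W with k i = n, ‖mFourierCoeff (H₁ n) k‖ ^ 2 :=
          Finset.sum_congr rfl fun k hk => by rw [(Finset.mem_filter.mp hk).2]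
      _ ≤ ∫ x : UnitAddTorus d, ‖H₁ n x‖ ^ 2 := sum_sq_norm_mFourierCoeff_le_integral (hH₁c n) _
  -- the fibre data on the fibres met by the window
  have hEF : ∀ n ∈ F, ∫ b : UnitAddCircle, ‖gmid n b‖ ^ 2 ≤ E n := by
    intro n hn; obtain ⟨k, hk, rfl⟩ := Finset.mem_image.mp hn; exact hE k hk
  have hSF : ∀ n ∈ F, ∀ x : UnitAddTorus d, ‖A₁ n x‖ ≤ S n := by
    intro n hn x; obtain ⟨k, hk, rfl⟩ := Finset.mem_image.mp hn; exact hS k hk x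
  -- on each fibre: `∫‖H₁ n‖² ≤ S_n² ∫_𝕋 ‖g^mid_n‖² ≤ E_n S_n²`
  have hle : ∀ n ∈ F, ∫ x : UnitAddTorus d, ‖H₁ n x‖ ^ 2 ≤ E n * S n ^ 2 := by
    intro n hn
    have hS0 : 0 ≤ S n := (norm_nonneg _).trans (hSF n hn 0)
    have hpt : ∀ x : UnitAddTorus d, ‖H₁ n x‖ ^ 2 ≤ S n ^ 2 * ‖gmid n (x j)‖ ^ 2 := by
      intro x
      simp only [hH₁, norm_mul, mul_pow]
      nlinarith [pow_le_pow_left₀ (norm_nonneg _) (hSF n hn x) 2, sq_nonneg ‖gmid n (x j)‖]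
    have hgj : Continuous fun x : UnitAddTorus d => ‖gmid n (x j)‖ ^ 2 :=
      (continuous_norm.comp ((hgmid n).comp (continuous_apply j))).pow 2
    calc ∫ x : UnitAddTorus d, ‖H₁ n x‖ ^ 2 ≤ ∫ x : UnitAddTorus d, S n ^ 2 * ‖gmid n (x j)‖ ^ 2 :=
          integral_mono ((continuous_norm.comp (hH₁c n)).pow 2).integrable_unitAddTorus
            (continuous_const.mul hgj).integrable_unitAddTorus hpt
      _ = S n ^ 2 * ∫ b : UnitAddCircle, ‖gmid n b‖ ^ 2 := by
          rw [integral_const_mul]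
          congr 1
          exact K1Flat.integral_comp_eval_eq_integral_circle (d := d) ((continuous_norm.comp (hgmid n)).pow 2) j
      _ ≤ S n ^ 2 * E n := mul_le_mul_of_nonneg_left (hEF n hn) (sq_nonneg _)
      _ = E n * S n ^ 2 := mul_comm _ _
  exact hfib.trans (Finset.sum_le_sum hle)

/-- **THE WINDOW LEMMA, fibrewise `L²` mid-band form.**  Data as in `…FibreWindow.sum_window_sq_norm_comp_shearMap_le`
(transversal shear `Φ = shearMap i j φ`, finite window `W`, input split `θ = θ₁ + θ₂`, chirp split `g_n = g^mid_n + g^rest_n` with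
exact separation), but instead of a common pointwise majorant of the `g^mid_n` one supplies per fibre `n` met by `W`:
the `L²(𝕋)` mass `∫‖g^mid_n‖² ≤ E_n` and a sup bound `‖A^i_nθ₁‖ ≤ S_n` on the fibre coefficient of the input.  Then
`Σ_{k∈W}‖𝓕((θ₁+θ₂)∘Φ)(k)‖² ≤ (√(Σ_{n∈F}E_nS_n²) + √(Σ_{n∈F}∫‖A^i_nθ₂‖²))²`. [cite: Grafakos2014, Prop. 3.1.2 (5) and Prop. 3.2.7 (3)] -/
theorem sum_window_sq_norm_comp_shearMap_le_fibreL2 {θ₁ θ₂ : UnitAddTorus d → ℂ} (hθ₁ : Continuous θ₁)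
    (hθ₁s : Summable fun k => ‖mFourierCoeff θ₁ k‖) (hθ₂ : Continuous θ₂) {i j : d} (hij : i ≠ j) (P : ShearProfile)
    (W : Finset (d → ℤ)) (gmid grest : ℤ → UnitAddCircle → ℂ) (hgmid : ∀ n, Continuous (gmid n))
    (hgrest : ∀ n, Continuous (grest n)) (hsplit : ∀ k ∈ W, ∀ b, twist P (k i) b = gmid (k i) b + grest (k i) b)
    (hsep : ∀ k ∈ W, ∀ m : ℤ, fourierCoeff (grest (k i)) m * mFourierCoeff θ₁ (k - Pi.single j m) = 0)
    {E S : ℤ → ℝ} (hE : ∀ k ∈ W, ∫ b : UnitAddCircle, ‖gmid (k i) b‖ ^ 2 ≤ E (k i))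
    (hS : ∀ k ∈ W, ∀ x : UnitAddTorus d, ‖∫ s : UnitAddCircle, (fourier (-(k i)) s : ℂ) • θ₁ (x + Pi.single i s)‖ ≤ S (k i)) :
    ∑ k ∈ W, ‖mFourierCoeff ((fun x => θ₁ x + θ₂ x) ∘ shearMap i j P) k‖ ^ 2 ≤
      (Real.sqrt (∑ n ∈ W.image (fun k => k i), E n * S n ^ 2) +
        Real.sqrt (∑ n ∈ W.image (fun k => k i),
          ∫ x : UnitAddTorus d, ‖∫ s : UnitAddCircle, (fourier (-n) s : ℂ) • θ₂ (x + Pi.single i s)‖ ^ 2)) ^ 2 := by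
  classical
  set H₁ : ℤ → UnitAddTorus d → ℂ := fun n x => gmid n (x j) *
    ∫ s : UnitAddCircle, (fourier (-n) s : ℂ) • θ₁ (x + Pi.single i s) with hH₁
  set H₂ : ℤ → UnitAddTorus d → ℂ := fun n x => twist P n (x j) *
    ∫ s : UnitAddCircle, (fourier (-n) s : ℂ) • θ₂ (x + Pi.single i s) with hH₂
  have hH₂c : ∀ n, Continuous (H₂ n) := fun n =>
    ((continuous_twist P n).comp (continuous_apply j)).mul (continuous_twistedAxisAvg hθ₂ i n)
  have hcoef : ∀ k ∈ W, mFourierCoeff ((fun x => θ₁ x + θ₂ x) ∘ shearMap i j P) k =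
      mFourierCoeff (H₁ (k i)) k + mFourierCoeff (H₂ (k i)) k := by
    intro k hk
    have hsum : ((fun x => θ₁ x + θ₂ x) ∘ shearMap i j P) = (θ₁ ∘ shearMap i j P) + (θ₂ ∘ shearMap i j P) := by
      funext x; rfl
    rw [hsum, Torus.mFourierCoeff_add (F := ℂ) ((hθ₁.comp (continuous_shearMap i j P)).integrable_unitAddTorus)
      ((hθ₂.comp (continuous_shearMap i j P)).integrable_unitAddTorus),
      mFourierCoeff_comp_shearMap_eq_mid hθ₁ hθ₁s hij P (hgmid (k i)) (hgrest (k i)) k (hsplit k hk) (hsep k hk),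
      mFourierCoeff_comp_shearMap_eq_chirp hθ₂ hij P k]
  have hM : ∑ k ∈ W, ‖mFourierCoeff ((fun x => θ₁ x + θ₂ x) ∘ shearMap i j P) k‖ ^ 2 ≤
      (Real.sqrt (∑ k ∈ W, ‖mFourierCoeff (H₁ (k i)) k‖ ^ 2) + Real.sqrt (∑ k ∈ W, ‖mFourierCoeff (H₂ (k i)) k‖ ^ 2)) ^ 2 := by
    have h1 : ∑ k ∈ W, ‖mFourierCoeff ((fun x => θ₁ x + θ₂ x) ∘ shearMap i j P) k‖ ^ 2 ≤
        ∑ k ∈ W, (‖mFourierCoeff (H₁ (k i)) k‖ + ‖mFourierCoeff (H₂ (k i)) k‖) ^ 2 := by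
      refine Finset.sum_le_sum fun k hk => ?_
      rw [hcoef k hk]
      exact pow_le_pow_left₀ (norm_nonneg _) (norm_add_le _ _) 2
    have h2 := SpectralLeakage.sqrt_sum_add_sq_le W (a := fun k => ‖mFourierCoeff (H₁ (k i)) k‖)
      (b := fun k => ‖mFourierCoeff (H₂ (k i)) k‖) (fun k _ => norm_nonneg _) (fun k _ => norm_nonneg _)
    have h0 : 0 ≤ ∑ k ∈ W, (‖mFourierCoeff (H₁ (k i)) k‖ + ‖mFourierCoeff (H₂ (k i)) k‖) ^ 2 :=
      Finset.sum_nonneg fun k _ => sq_nonneg _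
    calc ∑ k ∈ W, ‖mFourierCoeff ((fun x => θ₁ x + θ₂ x) ∘ shearMap i j P) k‖ ^ 2
        ≤ ∑ k ∈ W, (‖mFourierCoeff (H₁ (k i)) k‖ + ‖mFourierCoeff (H₂ (k i)) k‖) ^ 2 := h1
      _ = (Real.sqrt (∑ k ∈ W, (‖mFourierCoeff (H₁ (k i)) k‖ + ‖mFourierCoeff (H₂ (k i)) k‖) ^ 2)) ^ 2 :=
          (Real.sq_sqrt h0).symm
      _ ≤ _ := pow_le_pow_left₀ (Real.sqrt_nonneg _) h2 2
  have hA := sum_sq_norm_mid_le_fibreL2 hθ₁ hij W gmid hgmid hE hS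
  have hB : ∑ k ∈ W, ‖mFourierCoeff (H₂ (k i)) k‖ ^ 2 ≤ ∑ n ∈ W.image (fun k => k i),
      ∫ x : UnitAddTorus d, ‖∫ s : UnitAddCircle, (fourier (-n) s : ℂ) • θ₂ (x + Pi.single i s)‖ ^ 2 := by
    set F : Finset ℤ := W.image fun k => k i with hF
    have hmaps : ∀ k ∈ W, k i ∈ F := fun k hk => Finset.mem_image_of_mem _ hk
    rw [← Finset.sum_fiberwise_of_maps_to hmaps]
    refine Finset.sum_le_sum fun n hn => ?_
    calc ∑ k ∈ W with k i = n, ‖mFourierCoeff (H₂ (k i)) k‖ ^ 2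
        = ∑ k ∈ W with k i = n, ‖mFourierCoeff (H₂ n) k‖ ^ 2 :=
          Finset.sum_congr rfl fun k hk => by rw [(Finset.mem_filter.mp hk).2]
      _ ≤ ∫ x : UnitAddTorus d, ‖H₂ n x‖ ^ 2 := sum_sq_norm_mFourierCoeff_le_integral (hH₂c n) _
      _ = ∫ x : UnitAddTorus d, ‖∫ s : UnitAddCircle, (fourier (-n) s : ℂ) • θ₂ (x + Pi.single i s)‖ ^ 2 :=
          integral_congr_ae (Eventually.of_forall fun x => by simp only [hH₂, norm_mul, norm_twist, one_mul])
  exact hM.trans (pow_le_pow_left₀ (by positivity) (add_le_add (Real.sqrt_le_sqrt hA) (Real.sqrt_le_sqrt hB)) 2)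

end Summit.AnomalousDissipation.AnomalousDissipation.Theorems.SawtoothPulseCascade.K1Window
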